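import Summits.ResolutionOfSingularities.ResolutionOfSingularities.Theorems.EquisingularLiftEquisingularLiftNatHostedRoundSeam
import Summits.ResolutionOfSingularities.ResolutionOfSingularities.Theorems.EquisingularLiftEquisingularLiftNatBoundaryWitnessedCentre
import Literature.AlgebraicGeometry.Resolution.SNCStrataSmooth
import HarnessLib

/-!
# [OURS · L1 W4.5(b) · EL♮(3) · WIDTH TABLE D5 «IMMATURE HOST», supplier row HPAIR] THE PAIR-ROUND SUPPLIER OF THE K5⁶ ENGINE, modulo two letter lemmas
# `TCPlus.hpair_supplier_of k hCL hEB : <HPAIR of ✓ target_elnat_of_letteredPrefixResolution (p669625) at n := 3, verbatim>`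

res-L1-w45b-stub-2 g16 (desk R54: «HPAIR = stub-2»).  OURS; NOT a statement of any manuscript ([Hironaka2017] is a candidate under adjudication, nothing of
it is asserted); AI-written, weaker than expert review.  No `sorry`; standard axioms; DEF-FREE; TWO explicit ∀-hypotheses (not named facts, ordinary
lemma-shaped binders to be discharged by their own files): (CL) «a letter NOT containing the round's centre and meeting it transversally (possibly not at
all) steps to its strict transform» (= ✓ Δ2b `preLetterClauses_strictTransform_of_curveRound` at `a = 0` for the trace + the blow-up of a regular letter
at étale `O`-points for (l-iii); res-L1-w45b-crit-3 F3 / res-L1-w45b-crit-2 l.83645 (b); res-L1-w45b-stub-4's row per R54) and (EB) «the round's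
exceptional letter `υ'⁻¹ Z` is born with the model `𝒞·𝒪_{X₂}`» (the curve twin of ✓ `TCPlus.letterDatum_newPlane`).  `--supports stmt-ResolutionOfSingularities-20148 --as helper`.

WHAT.  The HPAIR binder of the engine, at `n = 3`: at a `Ch`-stage with model square `j : F₁ ⟶ X'`, listed letters `Ls` (each a ✓ `TCPlus.LetterDatum`)
and the tag block `Kp`, a PAIR ROUND at the transversal crossing curve `Z` of two listed letters `A ≠ B` (`𝓘⟨cl A⟩ ⊔ 𝓘⟨cl B⟩ = 𝓘⟨Z⟩`, `Z ⊆ T`,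
`T ⊄ Z`, `Z̃` regular, curve clause, `F` regular at the closed points of `Z`; the tag ABSENT or HOSTING; every other letter transversal-or-away) and its
blow-up `υ' = Bl_Z` are matched by a `Ch`-stage `X₉ = Bl_𝒞 X'` with a model square for `F₃`, `St T` irreducible, `F₃` integral, a `LetterDatum` for
the strict transform of EVERY listed letter, and one for the new exceptional letter `υ'⁻¹ Z`.
PROOF (pure composition, res-L1-w45b-crit-3 F2 / res-L1-w45b-crit-2 (T1) honoured).  THE CENTRE IS BUILT FROM THE TAG'S MODELS WHEN THE TAG HOSTS:
`Kp = some (K, A', C')` with `{A', C'} = {A, B}` carries its own `𝓐', 𝓒'` and `𝓚 ≤ 𝓐' ⊔ 𝓒'`, so `𝒞 := 𝓐' ⊔ 𝓒'`; otherwise `𝒞 := 𝓐 ⊔ 𝓑` from the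
per-letter blocks (models are not unique; the per-letter witnesses of `A`, `B`, `K` are simply re-chosen after the round).  Then res-L1-w45b-lead-1's ✓
`isRegular_subscheme_sup_of_trace_crossing` / ✓ `flat_subschemeι_sup_of_trace_crossing` (trace by `comap_sup`, `hWdim` from the curve clause + T-DIM exactly
as in ✓ `Tower.hPair_of_coneWitness`), E1-legality by ✓ `image_support_subset_not_isGenericPoint_of_chain`, the blow-up and its model square by ✓
`modelStep_chain`, the 2-frames by ✓ `hFrame_of_ringKrullDim_redSub`, the members `A`, `B` and the hosting key letter by ✓ HT2′
`TCPlus.letterDatum_transport_hostedRound'` (`𝓐 ≤ 𝒞`, `𝓑 ≤ 𝒞`, `𝓚 ≤ 𝒞`; `≠ ⊥` from (l-iv) and `Chain.fibre`), the other letters by (CL), the birth by (EB).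
[folklore; pure composition of the cited tree theorems]
-/

set_option linter.dupNamespace false -- mandated namespace `Summit.<Summit>.<Problem>` of this single-conjunct summit
set_option linter.overlappingInstances false -- signatures carry `[IsDomain O] [IsDiscreteValuationRing O]`

noncomputable section

open CategoryTheory CategoryTheory.Limits AlgebraicGeometry TopologicalSpace Topology IsLocalRing
open Literature.AlgebraicGeometry.Resolution
open AlgebraicGeometry.Scheme.IdealSheafData
open Summit.ResolutionOfSingularities.ResolutionOfSingularities.Theses.EquisingularLift.Split
open Summit.ResolutionOfSingularities.ResolutionOfSingularities.Cruxes.EquisingularLift.StrataSplit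

namespace Summit.ResolutionOfSingularities.ResolutionOfSingularities.Cruxes.EquisingularLiftNat.Sections

/-- **HPAIR: the pair-round supplier of the K5⁶ engine at `n = 3`, modulo the crossed-letter lemma (CL) and the exceptional-birth lemma (EB).**
The conclusion is the engine's HPAIR hypothesis VERBATIM with `n := 3` (see the module docstring). [folklore; pure composition]
[OURS · L1 W4.5b · WIDTH TABLE D5, supplier row HPAIR] -/
theorem TCPlus.hpair_supplier_of (k : Type) [Field k] [IsAlgClosed k]
    (hCL : ∀ (O : Type) [CommRing O] [IsDomain O] [IsDiscreteValuationRing O] (θ : O →+* k), Function.Surjective θ →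
      ∀ {P X X₂ G G₂ : AlgebraicGeometry.Scheme.{0}} (q : P ⟶ AlgebraicGeometry.Spec (.of O)) (Y : Set P) (σ : X ⟶ P)
        [IsLocallyNoetherian X] [AlgebraicGeometry.IsIntegral X] [IsLocallyNoetherian X₂] [AlgebraicGeometry.IsIntegral X₂]
        [IsLocallyNoetherian G] [AlgebraicGeometry.IsIntegral G] [IsLocallyNoetherian G₂] [AlgebraicGeometry.IsIntegral G₂] [AlgebraicGeometry.IsProper (σ ≫ q)],
        Literature.AlgebraicGeometry.Resolution.Scheme.IsRegular X → Literature.AlgebraicGeometry.Resolution.Scheme.IsRegular X₂ →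
      ∀ (jG : G ⟶ X) (tG : G ⟶ AlgebraicGeometry.Spec (.of k)), IsPullback jG tG (σ ≫ q) (AlgebraicGeometry.Spec.map (CommRingCat.ofHom θ)) →
      -- the centre: a regular `O`-flat relative curve with reduced trace `𝓘⟨Z⟩`, 2-frames, off `Y`; downstairs `Z̃` regular, a curve, `G` regular along `Z`
      ∀ (C : X.IdealSheafData) (Z : Set G) (hZ : IsClosed Z),
        C.comap jG = AlgebraicGeometry.Scheme.IdealSheafData.vanishingIdeal (⟨Z, hZ⟩ : TopologicalSpace.Closeds G) → AlgebraicGeometry.Flat (C.subschemeι ≫ σ ≫ q) →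
        Literature.AlgebraicGeometry.Resolution.Scheme.IsRegular C.subscheme → C ≠ ⊥ →
        (∀ x ∈ C.support, ∃ c : Fin 2 → X.presheaf.stalk x, Ideal.span (Set.range c) = Literature.AlgebraicGeometry.Resolution.stalkIdeal C x ∧ IsQuasiRegular c) →
        σ '' (C.support : Set X) ⊆ {p : P | ¬ IsGenericPoint p Y} →
        (∀ z : ↥(redSub G Z hZ), IsRegularLocalRing ((redSub G Z hZ).presheaf.stalk z)) →
        (∀ z : ↥(redSub G Z hZ), IsClosed ({z} : Set ↥(redSub G Z hZ)) → ringKrullDim ((redSub G Z hZ).presheaf.stalk z) = ((1 : ℕ) : WithBot ℕ∞)) →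
        (∀ z ∈ Z, IsClosed ({z} : Set G) → IsRegularLocalRing (G.presheaf.stalk z)) →
      -- the round upstairs and downstairs, the new model square
      ∀ {τ : X₂ ⟶ X}, Literature.AlgebraicGeometry.Resolution.IsBlowup τ C →
      ∀ {υ₂ : G₂ ⟶ G}, Literature.AlgebraicGeometry.Resolution.IsBlowup υ₂ (AlgebraicGeometry.Scheme.IdealSheafData.vanishingIdeal (⟨Z, hZ⟩ : TopologicalSpace.Closeds G)) →
      ∀ (j₂ : G₂ ⟶ X₂) (t₂ : G₂ ⟶ AlgebraicGeometry.Spec (.of k)), IsPullback j₂ t₂ ((τ ≫ σ) ≫ q) (AlgebraicGeometry.Spec.map (CommRingCat.ofHom θ)) → j₂ ≫ τ = υ₂ ≫ jG →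
      -- (CL) a listed letter NOT containing the centre and meeting it transversally (possibly not at all) steps to its strict transform
      ∀ (L : Set G), TCPlus.LetterDatum O P q Y G X σ jG L →
        AlgebraicGeometry.Scheme.IdealSheafData.vanishingIdeal (⟨closure L, isClosed_closure⟩ : TopologicalSpace.Closeds G) ⊔
            AlgebraicGeometry.Scheme.IdealSheafData.vanishingIdeal (⟨Z, hZ⟩ : TopologicalSpace.Closeds G) =
          AlgebraicGeometry.Scheme.IdealSheafData.vanishingIdeal (⟨closure L ∩ Z, isClosed_closure.inter hZ⟩ : TopologicalSpace.Closeds G) →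
        (∀ z ∈ Z, IsClosed ({z} : Set G) →
          ¬ Literature.AlgebraicGeometry.Resolution.stalkIdeal (AlgebraicGeometry.Scheme.IdealSheafData.vanishingIdeal (⟨closure L, isClosed_closure⟩ : TopologicalSpace.Closeds G)) z ≤
            Literature.AlgebraicGeometry.Resolution.stalkIdeal (AlgebraicGeometry.Scheme.IdealSheafData.vanishingIdeal (⟨Z, hZ⟩ : TopologicalSpace.Closeds G)) z) →
        TCPlus.LetterDatum O P q Y G₂ X₂ (τ ≫ σ) j₂ (closure (υ₂ ⁻¹' (closure L \ Z))))
    (hEB : ∀ (O : Type) [CommRing O] [IsDomain O] [IsDiscreteValuationRing O] (θ : O →+* k), Function.Surjective θ →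
      ∀ {P X X₂ G G₂ : AlgebraicGeometry.Scheme.{0}} (q : P ⟶ AlgebraicGeometry.Spec (.of O)) (Y : Set P) (σ : X ⟶ P)
        [IsLocallyNoetherian X] [AlgebraicGeometry.IsIntegral X] [IsLocallyNoetherian X₂] [AlgebraicGeometry.IsIntegral X₂]
        [IsLocallyNoetherian G] [AlgebraicGeometry.IsIntegral G] [IsLocallyNoetherian G₂] [AlgebraicGeometry.IsIntegral G₂] [AlgebraicGeometry.IsProper (σ ≫ q)],
        Literature.AlgebraicGeometry.Resolution.Scheme.IsRegular X → Literature.AlgebraicGeometry.Resolution.Scheme.IsRegular X₂ →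
      ∀ (jG : G ⟶ X) (tG : G ⟶ AlgebraicGeometry.Spec (.of k)), IsPullback jG tG (σ ≫ q) (AlgebraicGeometry.Spec.map (CommRingCat.ofHom θ)) →
      -- the centre: a regular `O`-flat relative curve with reduced trace `𝓘⟨Z⟩`, 2-frames, off `Y`; downstairs `Z̃` regular, a curve, `G` regular along `Z`
      ∀ (C : X.IdealSheafData) (Z : Set G) (hZ : IsClosed Z),
        C.comap jG = AlgebraicGeometry.Scheme.IdealSheafData.vanishingIdeal (⟨Z, hZ⟩ : TopologicalSpace.Closeds G) → AlgebraicGeometry.Flat (C.subschemeι ≫ σ ≫ q) →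
        Literature.AlgebraicGeometry.Resolution.Scheme.IsRegular C.subscheme → C ≠ ⊥ →
        (∀ x ∈ C.support, ∃ c : Fin 2 → X.presheaf.stalk x, Ideal.span (Set.range c) = Literature.AlgebraicGeometry.Resolution.stalkIdeal C x ∧ IsQuasiRegular c) →
        σ '' (C.support : Set X) ⊆ {p : P | ¬ IsGenericPoint p Y} →
        (∀ z : ↥(redSub G Z hZ), IsRegularLocalRing ((redSub G Z hZ).presheaf.stalk z)) →
        (∀ z : ↥(redSub G Z hZ), IsClosed ({z} : Set ↥(redSub G Z hZ)) → ringKrullDim ((redSub G Z hZ).presheaf.stalk z) = ((1 : ℕ) : WithBot ℕ∞)) →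
        (∀ z ∈ Z, IsClosed ({z} : Set G) → IsRegularLocalRing (G.presheaf.stalk z)) →
      -- the round upstairs and downstairs, the new model square
      ∀ {τ : X₂ ⟶ X}, Literature.AlgebraicGeometry.Resolution.IsBlowup τ C →
      ∀ {υ₂ : G₂ ⟶ G}, Literature.AlgebraicGeometry.Resolution.IsBlowup υ₂ (AlgebraicGeometry.Scheme.IdealSheafData.vanishingIdeal (⟨Z, hZ⟩ : TopologicalSpace.Closeds G)) →
      ∀ (j₂ : G₂ ⟶ X₂) (t₂ : G₂ ⟶ AlgebraicGeometry.Spec (.of k)), IsPullback j₂ t₂ ((τ ≫ σ) ≫ q) (AlgebraicGeometry.Spec.map (CommRingCat.ofHom θ)) → j₂ ≫ τ = υ₂ ≫ jG →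
      -- (EB) the round's exceptional letter `υ₂⁻¹ Z` is BORN with the model `C·𝒪_{X₂}`
      TCPlus.LetterDatum O P q Y G₂ X₂ (τ ≫ σ) j₂ (υ₂ ⁻¹' Z)) :
    ∀ (O : Type) [CommRing O] [IsDomain O] [IsDiscreteValuationRing O] [IsAdicComplete (IsLocalRing.maximalIdeal O) O]
        [IsAlgClosed (IsLocalRing.ResidueField O)] (θ : O →+* k), Function.Surjective θ →
      ∀ (P : AlgebraicGeometry.Scheme.{0}) (q : P ⟶ AlgebraicGeometry.Spec (.of O)) (Y : Set P) (Ch : ∀ X' : AlgebraicGeometry.Scheme.{0}, (X' ⟶ P) → Set X' → Prop),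
        (∀ (X' X'' : AlgebraicGeometry.Scheme.{0}) (σ' : X' ⟶ P) (S' : Set X') (C : X'.IdealSheafData) (τ : X'' ⟶ X'),
          Ch X' σ' S' → Literature.AlgebraicGeometry.Resolution.IsBlowup τ C →
          Literature.AlgebraicGeometry.Resolution.Scheme.IsRegular C.subscheme → AlgebraicGeometry.Flat (C.subschemeι ≫ σ' ≫ q) →
          σ' '' (C.support : Set X') ⊆ {y | ¬ IsGenericPoint y Y} → (C.support : Set X') ∩ (σ' ≫ q) ⁻¹' {IsLocalRing.closedPoint O} ⊆ S' →
          Ch X'' (τ ≫ σ') (closure (τ ⁻¹' (S' \ (C.support : Set X'))))) → (∀ (X' : AlgebraicGeometry.Scheme.{0}) (σ' : X' ⟶ P) (S' : Set X'), Ch X' σ' S' →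
          Summit.ResolutionOfSingularities.ResolutionOfSingularities.Theses.EquisingularLift.Split.Chain P Y X' σ' S') →
        Y ⊆ q ⁻¹' {IsLocalRing.closedPoint O} → IsIrreducible Y → IsClosed Y →
        AlgebraicGeometry.IsIntegral P → IsLocallyNoetherian P → Literature.AlgebraicGeometry.Resolution.Scheme.IsRegular P →
        AlgebraicGeometry.IsProper q → AlgebraicGeometry.SmoothOfRelativeDimension 3 q →
      -- the stage and its model
      ∀ (X' : AlgebraicGeometry.Scheme.{0}) (σ' : X' ⟶ P) (S' : Set X'), Ch X' σ' S' → AlgebraicGeometry.IsIntegral X' →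
        IsLocallyNoetherian X' → Literature.AlgebraicGeometry.Resolution.Scheme.IsRegular X' → AlgebraicGeometry.IsDominant (σ' ≫ q) →
      ∀ (F₁ : AlgebraicGeometry.Scheme.{0}), AlgebraicGeometry.IsIntegral F₁ → ∀ (j : F₁ ⟶ X') (t : F₁ ⟶ AlgebraicGeometry.Spec (.of k)),
        IsPullback j t (σ' ≫ q) (AlgebraicGeometry.Spec.map (CommRingCat.ofHom θ)) → ∀ (T₁ : Set F₁), IsClosed T₁ → IsIrreducible T₁ → j '' T₁ = S' →
      ∀ (Ls : List (Set F₁)) (Kp : Option (Set F₁ × Set F₁ × Set F₁)), (∀ L ∈ Ls, TCPlus.LetterDatum O P q Y F₁ X' σ' j L) →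
        (∀ K A C : Set F₁, Kp = some (K, A, C) → (∃ (𝓚 𝓐 𝓒 : X'.IdealSheafData), (𝓚.comap j = AlgebraicGeometry.Scheme.IdealSheafData.vanishingIdeal (⟨closure K, isClosed_closure⟩ : TopologicalSpace.Closeds F₁) ∧ (∀ z : X', (Literature.AlgebraicGeometry.Resolution.stalkIdeal 𝓚 z).IsPrincipal) ∧ Literature.AlgebraicGeometry.Resolution.Scheme.IsRegular 𝓚.subscheme ∧ σ' '' (𝓚.support : Set X') ⊆ {y : ↥P | ¬ IsGenericPoint y Y} ∧ AlgebraicGeometry.Flat (𝓚.subschemeι ≫ σ' ≫ q)) ∧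
            (𝓐.comap j = AlgebraicGeometry.Scheme.IdealSheafData.vanishingIdeal (⟨closure A, isClosed_closure⟩ : TopologicalSpace.Closeds F₁) ∧ (∀ z : X', (Literature.AlgebraicGeometry.Resolution.stalkIdeal 𝓐 z).IsPrincipal) ∧ Literature.AlgebraicGeometry.Resolution.Scheme.IsRegular 𝓐.subscheme ∧ σ' '' (𝓐.support : Set X') ⊆ {y : ↥P | ¬ IsGenericPoint y Y} ∧ AlgebraicGeometry.Flat (𝓐.subschemeι ≫ σ' ≫ q)) ∧
            (𝓒.comap j = AlgebraicGeometry.Scheme.IdealSheafData.vanishingIdeal (⟨closure C, isClosed_closure⟩ : TopologicalSpace.Closeds F₁) ∧ (∀ z : X', (Literature.AlgebraicGeometry.Resolution.stalkIdeal 𝓒 z).IsPrincipal) ∧ Literature.AlgebraicGeometry.Resolution.Scheme.IsRegular 𝓒.subscheme ∧ σ' '' (𝓒.support : Set X') ⊆ {y : ↥P | ¬ IsGenericPoint y Y} ∧ AlgebraicGeometry.Flat (𝓒.subschemeι ≫ σ' ≫ q)) ∧ 𝓚 ≤ 𝓐 ⊔ 𝓒)) →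
      ∀ (A B Z : Set F₁) (hZ : IsClosed Z), A ∈ Ls → B ∈ Ls → A ≠ B →
        AlgebraicGeometry.Scheme.IdealSheafData.vanishingIdeal (⟨closure A, isClosed_closure⟩ : TopologicalSpace.Closeds F₁) ⊔ AlgebraicGeometry.Scheme.IdealSheafData.vanishingIdeal (⟨closure B, isClosed_closure⟩ : TopologicalSpace.Closeds F₁) =
          AlgebraicGeometry.Scheme.IdealSheafData.vanishingIdeal (⟨Z, hZ⟩ : TopologicalSpace.Closeds F₁) →
        Z ⊆ T₁ → ¬ T₁ ⊆ Z → (∀ z : ↥(redSub F₁ Z hZ), IsRegularLocalRing ((redSub F₁ Z hZ).presheaf.stalk z)) →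
        (∀ z : ↥(redSub F₁ Z hZ), IsClosed ({z} : Set ↥(redSub F₁ Z hZ)) → ringKrullDim ((redSub F₁ Z hZ).presheaf.stalk z) = ((1 : ℕ) : WithBot ℕ∞)) →
        (∀ z ∈ Z, IsClosed ({z} : Set F₁) → IsRegularLocalRing (F₁.presheaf.stalk z)) →
        (∀ K A' C' : Set F₁, Kp = some (K, A', C') → K ∈ Ls ∧ K ≠ A ∧ K ≠ B ∧ ((A' = A ∧ C' = B) ∨ (A' = B ∧ C' = A))) →
        (∀ L ∈ Ls, L ≠ A → L ≠ B → (∀ K A' C' : Set F₁, Kp = some (K, A', C') → L ≠ K) →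
          AlgebraicGeometry.Scheme.IdealSheafData.vanishingIdeal (⟨closure L, isClosed_closure⟩ : TopologicalSpace.Closeds F₁) ⊔ AlgebraicGeometry.Scheme.IdealSheafData.vanishingIdeal (⟨Z, hZ⟩ : TopologicalSpace.Closeds F₁) =
            AlgebraicGeometry.Scheme.IdealSheafData.vanishingIdeal (⟨closure L ∩ Z, isClosed_closure.inter hZ⟩ : TopologicalSpace.Closeds F₁) ∧
          ∀ z ∈ Z, IsClosed ({z} : Set F₁) →
            ¬ Literature.AlgebraicGeometry.Resolution.stalkIdeal (AlgebraicGeometry.Scheme.IdealSheafData.vanishingIdeal (⟨closure L, isClosed_closure⟩ : TopologicalSpace.Closeds F₁)) z ≤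
              Literature.AlgebraicGeometry.Resolution.stalkIdeal (AlgebraicGeometry.Scheme.IdealSheafData.vanishingIdeal (⟨Z, hZ⟩ : TopologicalSpace.Closeds F₁)) z) →
      ∀ (F₃ : AlgebraicGeometry.Scheme.{0}) (υ' : F₃ ⟶ F₁), Literature.AlgebraicGeometry.Resolution.IsBlowup υ' (AlgebraicGeometry.Scheme.IdealSheafData.vanishingIdeal (⟨Z, hZ⟩ : TopologicalSpace.Closeds F₁)) →
        ∃ (X₉ : AlgebraicGeometry.Scheme.{0}) (σ₉ : X₉ ⟶ P) (S₉ : Set X₉) (j₉ : F₃ ⟶ X₉) (t₉ : F₃ ⟶ AlgebraicGeometry.Spec (.of k)),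
          Ch X₉ σ₉ S₉ ∧ AlgebraicGeometry.IsIntegral X₉ ∧ IsLocallyNoetherian X₉ ∧ Literature.AlgebraicGeometry.Resolution.Scheme.IsRegular X₉ ∧ AlgebraicGeometry.IsDominant (σ₉ ≫ q) ∧
          IsPullback j₉ t₉ (σ₉ ≫ q) (AlgebraicGeometry.Spec.map (CommRingCat.ofHom θ)) ∧ j₉ '' (closure (υ' ⁻¹' (T₁ \ Z))) = S₉ ∧ IsClosed (closure (υ' ⁻¹' (T₁ \ Z))) ∧ IsIrreducible (closure (υ' ⁻¹' (T₁ \ Z))) ∧ AlgebraicGeometry.IsIntegral F₃ ∧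
          (∀ L ∈ Ls, TCPlus.LetterDatum O P q Y F₃ X₉ σ₉ j₉ (closure (υ' ⁻¹' (closure L \ Z)))) ∧ TCPlus.LetterDatum O P q Y F₃ X₉ σ₉ j₉ (υ' ⁻¹' Z) := by
  intro O _ _ _ _ _ θ hθ P q Y Ch hChStep hChSplit hYsp hYirr hYcl hPint hPnoeth hPreg hqprop hqsm X' σ' S' hCh' hX'int hX'noeth hX'reg hX'dom
    F₁ hF₁ j t hsq T₁ hT₁cl hT₁irr hjT₁ Ls Kp hLs hTag A B Z hZ hA hB hAB hcross hZT hTZ hZreg hZdim hFZreg hHost hOthers F₃ υ' hυ'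
  classical
  haveI := hPint; haveI := hPnoeth; haveI := hX'int; haveI := hX'noeth; haveI := hF₁; haveI := hqprop; haveI := hqsm
  have hch : Chain P Y X' σ' S' := hChSplit _ _ _ hCh'
  obtain ⟨-, -, hσ'prop⟩ := chain_isRegular P Y X' σ' S' hch hPnoeth hPreg
  haveI := hσ'prop
  haveI : IsProper (σ' ≫ q) := inferInstance
  haveI : IsClosedImmersion (Spec.map (CommRingCat.ofHom θ)) := IsClosedImmersion.spec_of_surjective _ hθ
  haveI hjci : IsClosedImmersion j := MorphismProperty.IsStableUnderBaseChange.of_isPullback hsq.flip inferInstance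
  haveI : IsLocallyNoetherian F₁ := LocallyOfFiniteType.isLocallyNoetherian j
  -- a letter's model is never `⊥`: (l-iv) and the fibre of the chain over the generic point of `Y`
  obtain ⟨ξ, hξ⟩ : ∃ ξ : P, IsGenericPoint ξ Y := QuasiSober.sober hYirr hYcl
  have hne0 : ∀ 𝓛 : X'.IdealSheafData, σ' '' (𝓛.support : Set X') ⊆ {p : P | ¬ IsGenericPoint p Y} → 𝓛 ≠ ⊥ := by
    intro 𝓛 hoff h0
    obtain ⟨ξ', hfib', -⟩ := Chain.fibre hch hξ
    have hmem : ξ' ∈ (𝓛.support : Set X') := by rw [h0, Scheme.IdealSheafData.support_bot]; trivial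
    have hgen : σ' ξ' = ξ := by
      have : ξ' ∈ σ' ⁻¹' {ξ} := by rw [hfib']; exact Set.mem_singleton ξ'
      exact this
    exact hoff ⟨ξ', hmem, rfl⟩ (hgen ▸ hξ)
  -- THE PAIR'S MODELS (from the TAG when it hosts, else from the per-letter blocks) and the key letter's incidence
  obtain ⟨𝓐, 𝓑, ⟨hA1, hA2, hA3, hA4, hA5⟩, ⟨hB1, hB2, hB3, hB4, hB5⟩, hKey⟩ :
      ∃ 𝓐 𝓑 : X'.IdealSheafData,
        (𝓐.comap j = vanishingIdeal (⟨closure A, isClosed_closure⟩ : Closeds F₁) ∧ (∀ z : X', (stalkIdeal 𝓐 z).IsPrincipal) ∧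
          Scheme.IsRegular 𝓐.subscheme ∧ σ' '' (𝓐.support : Set X') ⊆ {p : P | ¬ IsGenericPoint p Y} ∧ Flat (𝓐.subschemeι ≫ σ' ≫ q)) ∧
        (𝓑.comap j = vanishingIdeal (⟨closure B, isClosed_closure⟩ : Closeds F₁) ∧ (∀ z : X', (stalkIdeal 𝓑 z).IsPrincipal) ∧
          Scheme.IsRegular 𝓑.subscheme ∧ σ' '' (𝓑.support : Set X') ⊆ {p : P | ¬ IsGenericPoint p Y} ∧ Flat (𝓑.subschemeι ≫ σ' ≫ q)) ∧
        ∀ K A' C' : Set F₁, Kp = some (K, A', C') → ∃ 𝓚 : X'.IdealSheafData,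
          (𝓚.comap j = vanishingIdeal (⟨closure K, isClosed_closure⟩ : Closeds F₁) ∧ (∀ z : X', (stalkIdeal 𝓚 z).IsPrincipal) ∧
            Scheme.IsRegular 𝓚.subscheme ∧ σ' '' (𝓚.support : Set X') ⊆ {p : P | ¬ IsGenericPoint p Y} ∧ Flat (𝓚.subschemeι ≫ σ' ≫ q)) ∧
          𝓚 ≤ 𝓐 ⊔ 𝓑 := by
    cases Kp with
    | none =>
      obtain ⟨𝓐, h𝓐⟩ := hLs A hA
      obtain ⟨𝓑, h𝓑⟩ := hLs B hB
      exact ⟨𝓐, 𝓑, h𝓐, h𝓑, fun K A' C' h => by simp at h⟩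
    | some t =>
      obtain ⟨K₀, A₀, C₀⟩ := t
      obtain ⟨𝓚, 𝓐', 𝓒', hK', hA', hC', hinc⟩ := hTag K₀ A₀ C₀ rfl
      obtain ⟨-, -, -, hor⟩ := hHost K₀ A₀ C₀ rfl
      rcases hor with ⟨rfl, rfl⟩ | ⟨rfl, rfl⟩
      · refine ⟨𝓐', 𝓒', hA', hC', fun K A' C' h => ?_⟩
        simp only [Option.some.injEq, Prod.mk.injEq] at h
        obtain ⟨rfl, rfl, rfl⟩ := h
        exact ⟨𝓚, hK', hinc⟩
      · refine ⟨𝓒', 𝓐', hC', hA', fun K A' C' h => ?_⟩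
        simp only [Option.some.injEq, Prod.mk.injEq] at h
        obtain ⟨rfl, rfl, rfl⟩ := h
        exact ⟨𝓚, hK', sup_comm 𝓒' 𝓐' ▸ hinc⟩
  -- THE CENTRE `𝒞 := 𝓐 ⊔ 𝓑`: downstairs `Z = cl A ∩ cl B` with the REDUCED crossing
  have hZeq : Z = closure A ∩ closure B := by
    have h1 := congrArg (fun I : F₁.IdealSheafData => ((I.support : Closeds F₁) : Set F₁)) hcross
    simp only [Scheme.IdealSheafData.support_sup, Closeds.coe_inf, Scheme.IdealSheafData.coe_support_vanishingIdeal] at h1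
    exact h1.symm
  have hcZ : (⟨Z, hZ⟩ : Closeds F₁) = ⟨closure A ∩ closure B, isClosed_closure.inter isClosed_closure⟩ := Closeds.ext hZeq
  have hW1 : vanishingIdeal (⟨closure A, isClosed_closure⟩ : Closeds F₁) ⊔ vanishingIdeal (⟨closure B, isClosed_closure⟩ : Closeds F₁) =
      vanishingIdeal (⟨closure A ∩ closure B, isClosed_closure.inter isClosed_closure⟩ : Closeds F₁) := by rw [← hcZ]; exact hcross
  have hCj : (𝓐 ⊔ 𝓑).comap j = vanishingIdeal ⟨Z, hZ⟩ := by
    rw [Scheme.IdealSheafData.comap_sup, hA1, hB1, hcross]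
  -- the codimension binder at the CLOSED crossing points: `dim 𝒪_{Z̃,g} = 1` (curve clause) and `dim 𝒪_{X', j g} = 4` (T-DIM)
  have hWdim : ∀ g ∈ closure A ∩ closure B, IsClosed ({g} : Set F₁) →
      ringKrullDim (F₁.presheaf.stalk g ⧸ stalkIdeal (vanishingIdeal (⟨closure A ∩ closure B, isClosed_closure.inter isClosed_closure⟩ : Closeds F₁)) g) + 3 =
        ringKrullDim (X'.presheaf.stalk (j g)) := by
    intro g hg hgc
    rw [← hcZ]
    have hgZ : g ∈ Z := hZeq ▸ hg
    have hgr : g ∈ Set.range (redSubι F₁ Z hZ) := by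
      change g ∈ Set.range (vanishingIdeal (⟨Z, hZ⟩ : Closeds F₁)).subschemeι
      rw [Scheme.IdealSheafData.range_subschemeι, Scheme.IdealSheafData.coe_support_vanishingIdeal]; exact hgZ
    obtain ⟨z, hz⟩ := hgr
    have hzc : IsClosed ({z} : Set ↥(redSub F₁ Z hZ)) := by
      have h1 : ({z} : Set ↥(redSub F₁ Z hZ)) = (redSubι F₁ Z hZ) ⁻¹' {g} := by
        ext z'
        simp only [Set.mem_singleton_iff, Set.mem_preimage]
        constructor
        · rintro rfl; exact hz
        · intro h; exact (redSubι F₁ Z hZ).isClosedEmbedding.injective (h.trans hz.symm)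
      rw [h1]; exact hgc.preimage (redSubι F₁ Z hZ).continuous
    have h1 : ringKrullDim (F₁.presheaf.stalk g ⧸ stalkIdeal (vanishingIdeal (⟨Z, hZ⟩ : Closeds F₁)) g) = ((1 : ℕ) : WithBot ℕ∞) := by
      rw [← hz, ← Literature.AlgebraicGeometry.Resolution.ringKrullDim_stalk_subscheme]; exact hZdim z hzc
    have hjc : IsClosed ({j g} : Set X') := by
      have := j.isClosedMap _ hgc; rwa [Set.image_singleton] at this
    have hjs : (σ' ≫ q).base (j g) = closedPoint O := by
      have h2 : j g ∈ Set.range j := ⟨g, rfl⟩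
      rw [range_eq_preimage_of_isPullback hsq, range_specMap_of_surjective_of_field θ hθ] at h2
      exact h2
    have h4 : ringKrullDim (X'.presheaf.stalk (j g)) = ((3 + 1 : ℕ) : WithBot ℕ∞) :=
      ringKrullDim_stalk_eq_succ_of_chain q 3 hξ hch hjc hjs
    rw [h1, h4]; rfl
  have hW2 : ∀ z : ↥(vanishingIdeal (⟨closure A ∩ closure B, isClosed_closure.inter isClosed_closure⟩ : Closeds F₁)).subscheme,
      IsRegularLocalRing ((vanishingIdeal (⟨closure A ∩ closure B, isClosed_closure.inter isClosed_closure⟩ : Closeds F₁)).subscheme.presheaf.stalk z) := by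
    rw [← hcZ]; exact hZreg
  -- the centre is regular and `O`-flat (res-L1-w45b-lead-1's pair lemmas)
  have hCreg : Scheme.IsRegular (𝓐 ⊔ 𝓑).subscheme :=
    isRegular_subscheme_sup_of_trace_crossing hX'reg hsq hθ hA1 hA2 hB1 hB2 hW1 hW2 hWdim
  have hCfl : Flat ((𝓐 ⊔ 𝓑).subschemeι ≫ σ' ≫ q) :=
    flat_subschemeι_sup_of_trace_crossing hX'reg hsq hθ hA1 hA2 hB1 hB2 hW1 hW2 hWdim
  -- E1-legality of the centre upstairs: off the generic point of `Y` (from `T ⊄ Z`) and inside the letters' off-`Y` supports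
  have hoff : σ' '' ((𝓐 ⊔ 𝓑).support : Set X') ⊆ {y : P | ¬ IsGenericPoint y Y} :=
    image_support_subset_not_isGenericPoint_of_chain θ hθ q Y hYsp σ' S' hch j t hsq T₁ hjT₁ (𝓐 ⊔ 𝓑) Z hZ hCj hTZ
  -- the blow-up of the centre, its `Ch`-stage and the model square for `υ'`
  have hDT : (((vanishingIdeal (⟨Z, hZ⟩ : Closeds F₁)) : F₁.IdealSheafData).support : Set F₁) ⊆ T₁ := by
    rw [Scheme.IdealSheafData.coe_support_vanishingIdeal]; exact hZT
  have hTD : ¬ T₁ ⊆ (((vanishingIdeal (⟨Z, hZ⟩ : Closeds F₁)) : F₁.IdealSheafData).support : Set F₁) := by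
    rw [Scheme.IdealSheafData.coe_support_vanishingIdeal]; exact hTZ
  obtain ⟨X₃, τ₃, hτ₃⟩ := exists_isBlowup X' (𝓐 ⊔ 𝓑)
  obtain ⟨hX₃i, hX₃n, hX₃r, hX₃dom, hF₃i, hirr₃, j₃, t₃, hsq₃, hcomm₃, hCh₃⟩ :=
    modelStep_chain O k θ hθ P q Y hYirr hYcl Ch hChSplit hChStep X' σ' S' hCh' hX'reg hX'dom F₁ j t hsq T₁ hjT₁
      (𝓐 ⊔ 𝓑) (vanishingIdeal (⟨Z, hZ⟩ : Closeds F₁)) hCj hCreg hCfl hoff hDT hTD X₃ τ₃ hτ₃ F₃ υ' hυ'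
  rw [Scheme.IdealSheafData.coe_support_vanishingIdeal] at hirr₃ hCh₃
  haveI := hX₃n; haveI := hX₃i; haveI := hF₃i
  haveI hj₃ci : IsClosedImmersion j₃ := MorphismProperty.IsStableUnderBaseChange.of_isPullback hsq₃.flip inferInstance
  haveI : IsLocallyNoetherian F₃ := LocallyOfFiniteType.isLocallyNoetherian j₃
  -- the 2-frames of the centre (the curve clause and `n = 3`)
  have hfr : ∀ x ∈ (𝓐 ⊔ 𝓑).support, ∃ c : Fin 2 → X'.presheaf.stalk x, Ideal.span (Set.range c) = stalkIdeal (𝓐 ⊔ 𝓑) x ∧ IsQuasiRegular c :=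
    hFrame_of_ringKrullDim_redSub O k θ hθ P q Y hYirr hYcl hPnoeth hPreg Ch hChSplit T₁ Z hZ hZdim X' σ' S' j t (𝓐 ⊔ 𝓑) hCh' hX'int hX'noeth
      hX'reg hX'dom hsq hjT₁ hCj hCfl hCreg
  have hC0 : 𝓐 ⊔ 𝓑 ≠ ⊥ := fun h => hne0 𝓐 hA4 (le_bot_iff.mp (h ▸ le_sup_left))
  -- THE LETTERS after the round
  have hLA : TCPlus.LetterDatum O P q Y F₃ X₃ (τ₃ ≫ σ') j₃ (closure (υ' ⁻¹' (closure A \ Z))) :=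
    TCPlus.letterDatum_transport_hostedRound' O k θ hθ q Y σ' hX'reg j t hsq isClosed_closure 𝓐 hA1 hA2 hA3 hA4 hA5 (hne0 𝓐 hA4) (𝓐 ⊔ 𝓑)
      le_sup_left hZ hCj hCfl hCreg hfr hτ₃ hυ' j₃ t₃ hsq₃ hcomm₃
  have hLB : TCPlus.LetterDatum O P q Y F₃ X₃ (τ₃ ≫ σ') j₃ (closure (υ' ⁻¹' (closure B \ Z))) :=
    TCPlus.letterDatum_transport_hostedRound' O k θ hθ q Y σ' hX'reg j t hsq isClosed_closure 𝓑 hB1 hB2 hB3 hB4 hB5 (hne0 𝓑 hB4) (𝓐 ⊔ 𝓑)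
      le_sup_right hZ hCj hCfl hCreg hfr hτ₃ hυ' j₃ t₃ hsq₃ hcomm₃
  have hLs₃ : ∀ L ∈ Ls, TCPlus.LetterDatum O P q Y F₃ X₃ (τ₃ ≫ σ') j₃ (closure (υ' ⁻¹' (closure L \ Z))) := by
    intro L hL
    by_cases hLa : L = A
    · subst hLa; exact hLA
    by_cases hLb : L = B
    · subst hLb; exact hLB
    by_cases hLK : ∃ K A' C' : Set F₁, Kp = some (K, A', C') ∧ L = K
    · -- the hosting key letter, from the tag's incidence `𝓚 ≤ 𝓐 ⊔ 𝓑`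
      obtain ⟨K, A', C', hKp, rfl⟩ := hLK
      obtain ⟨𝓚, ⟨hK1, hK2, hK3, hK4, hK5⟩, hKC⟩ := hKey _ A' C' hKp
      exact TCPlus.letterDatum_transport_hostedRound' O k θ hθ q Y σ' hX'reg j t hsq isClosed_closure 𝓚 hK1 hK2 hK3 hK4 hK5 (hne0 𝓚 hK4)
        (𝓐 ⊔ 𝓑) hKC hZ hCj hCfl hCreg hfr hτ₃ hυ' j₃ t₃ hsq₃ hcomm₃
    · -- every other letter: transversal-or-away (CL)
      push Not at hLK
      obtain ⟨hc1, hc2⟩ := hOthers L hL hLa hLb (fun K A' C' hKp hLK' => hLK K A' C' hKp hLK')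
      exact hCL O θ hθ q Y σ' hX'reg hX₃r j t hsq (𝓐 ⊔ 𝓑) Z hZ hCj hCfl hCreg hC0 hfr hoff hZreg hZdim hFZreg hτ₃ hυ' j₃ t₃ hsq₃ hcomm₃
        L (hLs L hL) hc1 hc2
  -- THE BIRTH of the exceptional letter (EB)
  have hE₃ : TCPlus.LetterDatum O P q Y F₃ X₃ (τ₃ ≫ σ') j₃ (υ' ⁻¹' Z) :=
    hEB O θ hθ q Y σ' hX'reg hX₃r j t hsq (𝓐 ⊔ 𝓑) Z hZ hCj hCfl hCreg hC0 hfr hoff hZreg hZdim hFZreg hτ₃ hυ' j₃ t₃ hsq₃ hcomm₃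
  exact ⟨X₃, τ₃ ≫ σ', _, j₃, t₃, hCh₃, hX₃i, hX₃n, hX₃r, hX₃dom, hsq₃, rfl, isClosed_closure, hirr₃, hF₃i, hLs₃, hE₃⟩

end Summit.ResolutionOfSingularities.ResolutionOfSingularities.Cruxes.EquisingularLiftNat.Sections

end
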